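import Literature.MathematicalPhysics.QuantumFieldTheory.Balaban1983to89.Node00.Record13SepCoPH
import Literature.MathematicalPhysics.QuantumFieldTheory.Balaban1983to89.T4StabilitySocket
import Summits.QuantumFields.YangMills.Theorems.BalabanUVNodesN13Cor3Repr218LeavesAtRecord13CoPH
import Summits.QuantumFields.YangMills.Theorems.BalabanUVNodesN21StepWeightsPositivity
import Literature.MathematicalPhysics.QuantumFieldTheory.Balaban1983to89.Node00.Record9InhabitedSU1

/-!
# BalabanUVNodes ∕ N13 — CAPSTONE: THE LADDER's (G2)∕(G5) STABILITY SOCKET AT K1⁷'s RECORD `datumOfRecord₁₃SepCoPH θ h` FROM THREE DISPLAYED COR.-3 LEAVES (U1, U2, L2) ON THE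
# RECORD's HISTORIES — `T4StabilitySocket.lowEnvelope_of_cor3With` with `hsign` (this seat's p588052 §1), `hsites` (p588052 §5), leaf (H) (p592785) and leaf (L1) (p594664) ALL DISCHARGED at the
# record; left displayed: Theorem 1's conclusion on the window (`hS`: N11∕N13's 𝐑-row), U1∕U2∕L2, NODE O's tuning, the observable family, (α), (γ), the numerator envelope
# (Track A, DAG node N13 = [B16]; cluster K1 — K1⁷ `StabilityBAtRecordR13SepCoPH` = stmt-QuantumFields-20542, helper; seat `pub-ymgap-dag-n13-w3` g0; 2026-08-28; count-neutral)

HONEST FRAMING.  Count-neutral kernel COMPOSITION BY NAME of this seat's six landed files; nothing of Bałaban's is asserted; Cor. 3 is NOT proved (U1∕U2∕L2 displayed); Theorem 1 at the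
record enters only as its conclusion on the window (`hS`, displayed); NODE O's tuning and the socket's (α)∕(γ)∕numerator binders are displayed exactly as in `T4StabilitySocket`.  The v1.7
`SepCoPH` datum IS the core-keyed `CoPH` datum at `h.toCore` (def-T's `rfl` bridge), which is how the `CoPH`-keyed leaves feed the `SepCoPH`-keyed socket.  Leaf (L1) enters as the PROOF TERM of
p594664's `leafL1_at_record₁₃_of_provisos₁₃CoPH` (dag-n21-d's `zetaOfRecord_nonneg` on `h.toCore.zetaUnity ∕ .zetaAbs` → `wOfRecord_nonneg` → K0's `slotsOfRecord_nonneg`, × `chiSeqOfRecord_nonneg`),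
written inline so that this file imports p592785 directly (no new (L1) declaration here — p594664 is its declarer); likewise `hsign` and `hsites` enter as the proof terms of p588052's
`signConventions_datumOfRecord₁₃SepCoPH` ∕ `numSites_datumOfRecord₁₃SepCoPH_top_le` (that module imports the route file; this capstone stays outside the theses cone).  N13 NOT discharged; K0⁷ ∕ K1⁷ NOT
closed; counts unmoved (discharged 5∕27 · Track A 5∕28).  The Yang–Mills mass gap (Clay) is NOT proved by any of this; rung R4 `BalabanLadder.UV` (conditional finite-𝕋⁴ bookkeeping) is the
only thing the K-items close.  ONE finite four-torus programme at fixed `ε = L^{-K}`; nothing continuum ∕ ℝ⁴ ∕ OS.  No `sorry`, `def`, `instance`, `notation`.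

WHAT THIS FILE PROVES (2 theorems).  ★★★ `lowEnvelope_datumOfRecord₁₃SepCoPH_of_U1_U2_L2` — `LowEnvelope l₀ T A (nlowOf l₀ B e₋⁺ (2L^m)⁴ c₀) nup (constOf … Nup) K₀` at `D := datumOfRecord₁₃SepCoPH F N θ h`
from: `hS` (Thm 1's conclusion `SLaw₁₃CoPH` on `]0, γB]`), U1∕U2∕L2 on `]0, γB]` (guarded as adv3 guards them), `γ ≤ γB`, tuning `D.Tuned γ g g₀`, run-index map `κ`, a measurable bounded observable
family, (α) `hα`, (γ) `hfloor`, numerator envelope `hnup` — `e₋⁺ = max (e₋ g) 0`; `cor3With_datumOfRecord₁₃SepCoPH_of_U1_U2_L2` (the `Cor3With` it goes through, at K1⁷'s tokens).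

Sources: [Balaban1988Convergent] Thm 1 p.262, Cor. 3 (2.50) p.264, (2.18) p.257, (3.16) p.268, (3.21) p.269; [Balaban1989LargeFieldII] Thm 1 p.355, (0.1) pp.355–356; [Balaban1987RG1] (0.1) p.251,
Thm 2 p.259 (tuning, bookkeeping).
-/

noncomputable section

open MeasureTheory
open scoped BigOperators

namespace Summit.QuantumFields.YangMills.BalabanUVNodes.N13StabilitySocketOfLeavesAtRecord13SepCoPH

open Literature.MathematicalPhysics.QuantumFieldTheory.Balaban1983to89
open T4Continuum T4DatumAssembly Node00 DagBinding FlowStepRuns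
open Literature.MathematicalPhysics.QuantumFieldTheory.Balaban1983to89.T4StabilitySocket (smallFieldMass LowEnvelope nlowOf constOf)
open Summit.QuantumFields.YangMills.BalabanUVNodes.N13Cor3Repr218LeavesAtRecord13CoPH (cor3With_datumOfRecord₁₃CoPH_of_repr218Leaves)
open Summit.QuantumFields.YangMills.Theorems.N21StepWeightsPositivity (zetaOfRecord_nonneg)

variable (F : T4Family) (N : ℕ) [NeZero N]
variable (θ : Stage13HParams F N) (h : θ.Provisos₁₃SepCoPH F N)

/-- **[III] COR. 3 «WITH e±» AT K1⁷'s TOKENS (`datumOfRecord₁₃SepCoPH`) FROM THREE LEAVES** — p592785's `cor3With_datumOfRecord₁₃CoPH_of_repr218Leaves` at `h.toCore` (def-T's `rfl` bridge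
`datumOfRecord₁₃SepCoPH F N θ h = datumOfRecord₁₃CoPH F N θ h.toCore`) with leaf (L1) supplied by the proof term of p594664's `leafL1_at_record₁₃_of_provisos₁₃CoPH` (`ζ ≥ 0` from rows
`zetaUnity`∕`zetaAbs`, dag-n21-d's `zetaOfRecord_nonneg`; slots `≥ 0` by K0's `slotsOfRecord_nonneg`; `χ_k(s) ≥ 0`).  CONDITIONAL on `hS`, U1, U2, L2; nothing of Bałaban's asserted. [cite: Balaban1988Convergent, Thm 1 p.262, Cor. 3 (2.50) p.264 (bookkeeping)] -/
theorem cor3With_datumOfRecord₁₃SepCoPH_of_U1_U2_L2 (γ : ℝ) (em ep : ℝ → ℝ)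
    (major : (P : B12.RunParams) → (k : ℕ) → (reprOfRecord₁₃ F N θ.toStage13Params P k).Adm → ℝ)
    (s₀ : (P : B12.RunParams) → (k : ℕ) → (reprOfRecord₁₃ F N θ.toStage13Params P k).Adm)
    (hS : ∀ P : B12.RunParams, ((datumOfRecord₁₃SepCoPH F N θ h).C P).flow.InInterval γ P.K → ∀ k, k ≤ P.K → SLaw₁₃CoPH F N θ P k)
    (hU1 : ∀ P : B12.RunParams, ((datumOfRecord₁₃SepCoPH F N θ h).C P).flow.InInterval γ P.K → ∀ k, k ≤ P.K → SLaw₁₃CoPH F N θ P k →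
      ∀ s V, (reprOfRecord₁₃ F N θ.toStage13Params P k).χ s V * (reprOfRecord₁₃ F N θ.toStage13Params P k).TexpA s V ≤ major P k s)
    (hU2 : ∀ P : B12.RunParams, ((datumOfRecord₁₃SepCoPH F N θ h).C P).flow.InInterval γ P.K → ∀ k, k ≤ P.K → SLaw₁₃CoPH F N θ P k →
      ∑ s, major P k s ≤ Real.exp (ep (gOfRecord₁₃ F N θ.toStage13Params P k) * (Fintype.card (Site (F.P P.K) k) : ℝ)))
    (hL2 : ∀ P : B12.RunParams, ((datumOfRecord₁₃SepCoPH F N θ h).C P).flow.InInterval γ P.K → ∀ k, k ≤ P.K → SLaw₁₃CoPH F N θ P k →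
      ∀ V, chiβOfRecord₁₃ F N θ.toStage13Params P.K (gOfRecord₁₃ F N θ.toStage13Params P) k V *
          Real.exp (-(1 / (gOfRecord₁₃ F N θ.toStage13Params P k) ^ 2 * wilsonBGOfRecord F N θ.εbg P k V)
            - em (gOfRecord₁₃ F N θ.toStage13Params P k) * (Fintype.card (Site (F.P P.K) k) : ℝ)) ≤
        (reprOfRecord₁₃ F N θ.toStage13Params P k).χ (s₀ P k) V * (reprOfRecord₁₃ F N θ.toStage13Params P k).TexpA (s₀ P k) V) :
    B16.Cor3With (datumOfRecord₁₃SepCoPH F N θ h).C γ em ep :=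
  cor3With_datumOfRecord₁₃CoPH_of_repr218Leaves F N θ h.toCore γ em ep major s₀ hS hU1 hU2
    (fun P _ k _ _ s V =>
      mul_nonneg (chiSeqOfRecord_nonneg F N θ.ν θ.τ9.M (gOfRecord₁₃ F N θ.toStage13Params P) P.K k s V)
        (slotsOfRecord_nonneg F N θ.ν θ.τ9 (EOfRecord₁₃ F N θ.toStage13Params)
          (fun p g k s' U V' => wOfRecord_nonneg F N θ.ν θ.τ9.M p g k θ.A₁
            (zetaOfRecord_nonneg F N θ.ν θ.τ9.M h.toCore.zetaUnity h.toCore.zetaAbs) s' U V')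
          θ.ppSel P (gOfRecord₁₃ F N θ.toStage13Params P) k s V))
    hL2


/-- **★★★ THE LADDER's (G2)∕(G5) STABILITY SOCKET AT K1⁷'s RECORD FROM THREE COR.-3 LEAVES** (`T4StabilitySocket.lowEnvelope_of_cor3With` with `hsign`, `hsites`, leaf (H), leaf (L1) ALL
DISCHARGED at the record: p588052 §1∕§5, p592785, p594664's argument).  Displayed: `hS` = Theorem 1's conclusion `SLaw₁₃CoPH` on `]0, γB]` (N11∕N13's 𝐑-row), U1∕U2∕L2 on `]0, γB]`, `γ ≤ γB`, NODE O's tuning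
`Tuned γ g g₀`, the run-index map `κ`, a measurable bounded observable family, (α) `hα`, (γ) `hfloor`, the numerator envelope `hnup`.  Conclusion: `LowEnvelope l₀ T A (nlowOf l₀ B e₋⁺ (2L^m)⁴ c₀) nup
(constOf l₀ B e₋⁺ (2L^m)⁴ c₀ Nup) K₀`, `e₋⁺ = max (e₋ g) 0`.  CONDITIONAL on every displayed input; nothing of Bałaban's asserted; count-neutral.
[cite: Balaban1988Convergent, Cor. 3 (2.50) p.264; Balaban1989LargeFieldII, (0.1) pp.355–356; Balaban1987RG1, Thm 2 p.259 (bookkeeping)] -/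
theorem lowEnvelope_datumOfRecord₁₃SepCoPH_of_U1_U2_L2
    {γB γ g : ℝ} {em ep : ℝ → ℝ} {g₀ : ℕ → ℝ}
    (major : (P : B12.RunParams) → (k : ℕ) → (reprOfRecord₁₃ F N θ.toStage13Params P k).Adm → ℝ)
    (s₀ : (P : B12.RunParams) → (k : ℕ) → (reprOfRecord₁₃ F N θ.toStage13Params P k).Adm)
    (hS : ∀ P : B12.RunParams, ((datumOfRecord₁₃SepCoPH F N θ h).C P).flow.InInterval γB P.K → ∀ k, k ≤ P.K → SLaw₁₃CoPH F N θ P k)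
    (hU1 : ∀ P : B12.RunParams, ((datumOfRecord₁₃SepCoPH F N θ h).C P).flow.InInterval γB P.K → ∀ k, k ≤ P.K → SLaw₁₃CoPH F N θ P k →
      ∀ s V, (reprOfRecord₁₃ F N θ.toStage13Params P k).χ s V * (reprOfRecord₁₃ F N θ.toStage13Params P k).TexpA s V ≤ major P k s)
    (hU2 : ∀ P : B12.RunParams, ((datumOfRecord₁₃SepCoPH F N θ h).C P).flow.InInterval γB P.K → ∀ k, k ≤ P.K → SLaw₁₃CoPH F N θ P k →
      ∑ s, major P k s ≤ Real.exp (ep (gOfRecord₁₃ F N θ.toStage13Params P k) * (Fintype.card (Site (F.P P.K) k) : ℝ)))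
    (hL2 : ∀ P : B12.RunParams, ((datumOfRecord₁₃SepCoPH F N θ h).C P).flow.InInterval γB P.K → ∀ k, k ≤ P.K → SLaw₁₃CoPH F N θ P k →
      ∀ V, chiβOfRecord₁₃ F N θ.toStage13Params P.K (gOfRecord₁₃ F N θ.toStage13Params P) k V *
          Real.exp (-(1 / (gOfRecord₁₃ F N θ.toStage13Params P k) ^ 2 * wilsonBGOfRecord F N θ.εbg P k V)
            - em (gOfRecord₁₃ F N θ.toStage13Params P k) * (Fintype.card (Site (F.P P.K) k) : ℝ)) ≤
        (reprOfRecord₁₃ F N θ.toStage13Params P k).χ (s₀ P k) V * (reprOfRecord₁₃ F N θ.toStage13Params P k).TexpA (s₀ P k) V)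
    (hγ : γ ≤ γB) (htuned : (datumOfRecord₁₃SepCoPH F N θ h).Tuned γ g g₀) (κ : ℕ → ℕ)
    {obs : (K : ℕ) → GaugeField (F.P K) 0 (SU N) → ℝ} {B l₀ : ℝ}
    (hobs : ∀ K, Measurable (obs K)) (hbd : ∀ K U, |obs K U| ≤ B)
    {ι : Type*} {T : ℕ → Finset ι} {A : ℕ → ℝ → ι → ℝ} {K₀ : ℕ}
    (hα : ∀ K t, |t| ≤ l₀ → K₀ ≤ K →
      ∫ U, Real.exp (t * obs (κ K) U) * (datumOfRecord₁₃SepCoPH F N θ h).dens (κ K) (g₀ (κ K)) 0 U ∂fieldMeasure (F.P (κ K)) 0 (SU N) ≤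
        ∑ τ ∈ T K, A K t τ)
    {c₀ : ℝ} (hc₀ : 0 < c₀) (hfloor : ∀ K, K₀ ≤ K → c₀ ≤ smallFieldMass (datumOfRecord₁₃SepCoPH F N θ h) (κ K) (g₀ (κ K)))
    {nup : ℕ → ℝ → ℝ} {Nup : ℝ} (hnup : ∀ K t, |t| ≤ l₀ → K₀ ≤ K → 0 ≤ nup K t ∧ nup K t ≤ Nup) :
    LowEnvelope l₀ T A (nlowOf l₀ B (max (em g) 0) ((2 * (F.L : ℝ) ^ F.m) ^ 4) c₀) nup
      (constOf l₀ B (max (em g) 0) ((2 * (F.L : ℝ) ^ F.m) ^ 4) c₀ Nup) K₀ :=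
  -- `hsign` (χ_k ≥ 0 at the record: K0e's `chiFix29OfRecord_mem_Icc`, = p588052's `signConventions_datumOfRecord₁₃SepCoPH`) and `hsites`
  -- (`|T₁^{(K)}| = (2L^m)⁴` at the final scale, = p588052's `numSites_datumOfRecord₁₃SepCoPH_top_le`) as inline proof terms (p588052 imports the route file; this capstone stays outside that cone).
  T4StabilitySocket.lowEnvelope_of_cor3With (datumOfRecord₁₃SepCoPH F N θ h)
    (fun p k V => (chiFix29OfRecord_mem_Icc θ.ν θ.ε₂₉ p.K k V).1)
    (cor3With_datumOfRecord₁₃SepCoPH_of_U1_U2_L2 F N θ h γB em ep major s₀ hS hU1 hU2 hL2) hγ htuned κ hobs hbd hα hc₀ hfloor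
    (fun K _ => by
      show (Fintype.card (Site (F.P (κ K)) (κ K)) : ℝ) ≤ (2 * (F.L : ℝ) ^ F.m) ^ 4
      rw [Site.card_site]
      simp [Params.sitesPerDir, T4Family.P, Missing.params4])
    hnup

end Summit.QuantumFields.YangMills.BalabanUVNodes.N13StabilitySocketOfLeavesAtRecord13SepCoPH

end
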